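import Literature.AnabelianGeometry.SemiGraphs.TemperedAbsoluteness
import Mathlib.NumberTheory.Padics.Complex
import HarnessLib

/-!
# [GalSect] §4 (p.33) and Def. 4.1 (i): the torsor of splittings at a cusp and changes of structure group

Mochizuki, *Galois sections in absolute anabelian geometry* [GalSect] (= [Mzk13] of [EtTh], [Mzk8] of
[SemiAnbd]), Nagoya Math. J. **179** (2005) 17–45, §4 "Discrete and integral structures at cusps", p.33 and
Def. 4.1 (i) pp.33–34 [cite: MochizukiGalSect2005, Def 4.1 p.33].  abc-iut cell, layer L2, row «N5 UNBLOCK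
[GalSect] §4 vocabulary» (abc-iut-L2-lead gen 2, 2026-08-26T02:50:10Z; seat abc-iut-w5-d062 gen 2); FILE 1
of 2 (sequel `GalSectIntegralStructures.lean`: Def. 4.1 (ii)(iii), Cor. 4.12, and the [EtTh] Prop. 1.4 (iii)
/ Thm. 1.10 (iii) consumers).  STATEMENTS-FIRST (review lane); the cheap proofs are included; no named fact
in this file.

**[GalSect] §4, p. 33 (verbatim).** "Let `D_x ⊆ Π_{X_K}` be a decomposition group associated to some cusp
`x ∈ X̄_K(K)`. Then we have an exact sequence `1 → I_x (≅ Ẑ(1)) → D_x → G_K → 1` whose splittings form a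
torsor over `H¹(G_K, Ẑ(1)) ≅ (K^×)^∧` [where the `∧` denotes the profinite completion]. If `ω_x` denotes
the cotangent space to `X̄_K` at `x`, then any choice of a nonzero `θ ∈ ω_x` determines a splitting of this
torsor … In particular, if … `X_K` has stable reduction over `O_K`, then … a natural integral structure on
`ω_x` … determines a reduction of the structure group of the torsor of splittings … from `(K^×)^∧` to
`O_K^×`."  **Def. 4.1 (i).** "If `(K^×)^∧ → A` is a continuous homomorphism of topological groups, then the
torsor obtained from the torsor of splittings … by changing the structure group via this homomorphism will
be referred to as the `A`-torsor at `x`. If, moreover, `B ⊆ A` is a closed subgroup, then any reduction of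
the structure group of the `A`-torsor at `x` from `A` to `B` will be referred to as a `B`-torsor structure
at `x`."

## How it is typed (read with the referee)

* LEVEL.  Group-theoretically, over the tree's curve-level interface `SemiGraphs.TemperedCurve p`
  ([SemiAnbd] §6; tempered `Π^temp_{X_K}` with cusps `x`, representatives `D_x = decomp x`,
  `I_x = inertia x`) and ON TOP of layer L3's `TemperedAbsoluteness.lean`, which already records a
  splitting by its image subgroup (`TemperedCurve.IsSplittingSubgroup`) and the canonical structures of
  Def. 4.1 (iii) as SETS of splitting subgroups (`SemiGraphs.CuspidalStructures`, interface data).  Nothing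
  of that is restated; this file supplies the TORSOR itself: print's structure group
  `H¹(G_K, Ẑ(1)) ≅ (K^×)^∧` acts simply transitively on splittings MODULO `I_x`-CONJUGATION (a section is
  its image subgroup; sections differing by a coboundary have `I_x`-conjugate images), and Def. 4.1 (i)
  (change / reduction of structure group).  [GalSect] works with the PROFINITE `Π_{X_K}`; [SemiAnbd] p.77
  ("`D̂_x` also forms a 'profinite `D_x ⊆ Π_{X_K}`' in the sense of [Mzk8]") licenses the tempered
  transcription (L3's convention).
* WHAT IS DATA (no carrier in the tree; plan/FOUNDATIONS.md rows 10, 15): the simply transitive ACTION of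
  `(K^×)^∧` on the splitting classes (= the Kummer / local-class-field-theory identification
  `H¹(G_K, I_x) ≅ H¹(G_K, Ẑ(1)) ≅ (K^×)^∧` together with the `H¹`-torsor structure): the structure
  `CuspidalTorsorData X x`, certified only through the origin predicate `CuspidalTorsorOrigin.IsTorsorOrigin`
  of the sequel.  `(K^×)^∧` itself is REAL: Mathlib's profinite completion of `K^×` (`KxHat`, built as the
  tree's `SemiGraphs.ZHat`), with its canonical map `K^× → (K^×)^∧` (`toKxHat`).
* WHAT IS REAL: splittings, conjugation of splittings by `D_x` and `I_x` (PROVED to preserve them),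
  splitting classes, the change-of-structure-group torsor `A ×^{(K^×)^∧} T` (a genuine quotient type with
  its `A`-action, PROVED well defined and compatible with the structure map), reductions of structure group
  as `B`-orbits.

READING NOTE (R1, recorded, not resolved): "torsor over `H¹`" is typed as a torsor of splitting CLASSES
(splittings modulo `I_x`-conjugation); for `I_x ≅ Ẑ(1)` over a `p`-adic `G_K` one has `H⁰(G_K, Ẑ(1)) = 0`,
so each class is itself a free `I_x`-orbit — not used.  HONEST FRAMING: [GalSect] is a refereed paper;
nothing printed is asserted; typed ≠ proved; the abc-iut cell takes no side on [IUTchIII] Cor. 3.12, on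
which nothing here bears.
-/

noncomputable section

open scoped Pointwise

namespace Literature.AnabelianGeometry.EtaleTheta

open Literature.AnabelianGeometry.SemiGraphs

namespace GalSect


variable {p : ℕ} [Fact p.Prime]

/-! ### [GalSect] §4 p.33: splittings of `1 → I_x → D_x → G_K → 1`, their conjugates, splitting classes -/

/-- The set of **splittings** of `1 → I_x → D_x → G_K → 1` at the cusp `x` ([GalSect] §4 p.33), each
recorded by its image — a closed `S ≤ D_x` with `S ∩ I_x = 1`, `S · I_x = D_x` (L3's
`TemperedCurve.IsSplittingSubgroup`, cited, not restated). [cite: MochizukiGalSect2005, §4 p.33] -/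
def splittings (X : TemperedCurve p) (x : X.Pt) : Set (Subgroup X.PiTemp) :=
  {S | X.IsSplittingSubgroup x S}

/-- Membership in `splittings` is L3's predicate. [cite: MochizukiGalSect2005, §4 p.33] -/
theorem mem_splittings_iff (X : TemperedCurve p) (x : X.Pt) (S : Subgroup X.PiTemp) :
    S ∈ splittings X x ↔ X.IsSplittingSubgroup x S :=
  Iff.rfl

/-- `I_x = D_x ∩ Δ^temp_X` is normalised by `D_x` (`Δ^temp_X = Ker(Π^temp → G_{ℚ_p})` is normal) — PROVED.
[cite: MochizukiGalSect2005, §4 p.33] -/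
theorem conj_inertia_eq (X : TemperedCurve p) (x : X.Pt) {d : X.PiTemp} (hd : d ∈ X.decomp x) :
    MulAut.conj d • X.inertia x = X.inertia x := by
  have hN : X.DeltaTemp.Normal := inferInstanceAs X.aug.toMonoidHom.ker.Normal
  have hΔ : MulAut.conj d • X.DeltaTemp = X.DeltaTemp := by
    ext y
    rw [Subgroup.mem_smul_pointwise_iff_exists]
    constructor
    · rintro ⟨z, hz, rfl⟩
      rw [MulAut.smul_def, MulAut.conj_apply]
      exact hN.conj_mem z hz d
    · intro hy
      refine ⟨d⁻¹ * y * d, ?_, ?_⟩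
      · have := hN.conj_mem y hy d⁻¹
        simpa only [inv_inv, mul_assoc] using this
      · rw [MulAut.smul_def, MulAut.conj_apply]
        group
  have hD : MulAut.conj d • X.decomp x = X.decomp x := by
    ext y
    rw [Subgroup.mem_smul_pointwise_iff_exists]
    constructor
    · rintro ⟨z, hz, rfl⟩
      rw [MulAut.smul_def, MulAut.conj_apply]
      exact (X.decomp x).mul_mem ((X.decomp x).mul_mem hd hz) ((X.decomp x).inv_mem hd)
    · intro hy
      refine ⟨d⁻¹ * y * d, (X.decomp x).mul_mem ((X.decomp x).mul_mem ((X.decomp x).inv_mem hd) hy) hd,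
        ?_⟩
      rw [MulAut.smul_def, MulAut.conj_apply]
      group
  change MulAut.conj d • (X.decomp x ⊓ X.DeltaTemp) = X.decomp x ⊓ X.DeltaTemp
  rw [Subgroup.smul_inf, hD, hΔ]

/-- **Conjugation by `D_x` permutes the splittings** (a section `s` and `d·s·d⁻¹` are both sections; in
particular `I_x` acts on the splittings) — PROVED. [cite: MochizukiGalSect2005, §4 p.33] -/
theorem conj_mem_splittings (X : TemperedCurve p) (x : X.Pt) {d : X.PiTemp} (hd : d ∈ X.decomp x)
    {S : Subgroup X.PiTemp} (hS : S ∈ splittings X x) : MulAut.conj d • S ∈ splittings X x := by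
  obtain ⟨hcl, hle, hinf, hsup⟩ := hS
  have hD : ∀ T : Subgroup X.PiTemp, T ≤ X.decomp x → MulAut.conj d • T ≤ X.decomp x := by
    intro T hT y hy
    obtain ⟨z, hz, rfl⟩ := (Subgroup.mem_smul_pointwise_iff_exists y _ T).mp hy
    rw [MulAut.smul_def, MulAut.conj_apply]
    exact (X.decomp x).mul_mem ((X.decomp x).mul_mem hd (hT hz)) ((X.decomp x).inv_mem hd)
  refine ⟨?_, hD S hle, ?_, ?_⟩
  · -- closedness: conjugation is a homeomorphism of `Π^temp`
    have : ((MulAut.conj d • S : Subgroup X.PiTemp) : Set X.PiTemp) =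
        (fun y => d * y * d⁻¹) '' (S : Set X.PiTemp) := by
      ext y
      simp only [Subgroup.coe_pointwise_smul, Set.mem_smul_set, Set.mem_image, SetLike.mem_coe,
        MulAut.smul_def, MulAut.conj_apply]
    rw [this]
    exact (Homeomorph.mulRight d⁻¹ |>.isClosedMap) _
      ((Homeomorph.mulLeft d |>.isClosedMap) _ hcl) |> fun h => by
        simpa only [Set.image_image, Homeomorph.coe_mulLeft, Homeomorph.coe_mulRight] using h
  · rw [← conj_inertia_eq X x hd, ← Subgroup.smul_inf, hinf, Subgroup.smul_bot]
  · rw [← conj_inertia_eq X x hd, ← Subgroup.smul_sup, hsup]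
    -- `d · D_x · d⁻¹ = D_x`
    apply le_antisymm (hD _ le_rfl)
    intro y hy
    refine (Subgroup.mem_smul_pointwise_iff_exists y _ _).mpr ⟨d⁻¹ * y * d,
      (X.decomp x).mul_mem ((X.decomp x).mul_mem ((X.decomp x).inv_mem hd) hy) hd, ?_⟩
    rw [MulAut.smul_def, MulAut.conj_apply]
    group

/-- Two splittings are **`I_x`-conjugate** (they come from sections differing by a coboundary).
[cite: MochizukiGalSect2005, §4 p.33] -/
def InertiaConj (X : TemperedCurve p) (x : X.Pt) (S T : Subgroup X.PiTemp) : Prop :=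
  ∃ i ∈ X.inertia x, T = MulAut.conj i • S

/-- `I_x`-conjugacy is an equivalence relation on subgroups — PROVED. [cite: MochizukiGalSect2005, §4 p.33] -/
theorem inertiaConj_equivalence (X : TemperedCurve p) (x : X.Pt) : Equivalence (InertiaConj X x) where
  refl S := ⟨1, (X.inertia x).one_mem, by simp⟩
  symm := by
    rintro S T ⟨i, hi, rfl⟩
    exact ⟨i⁻¹, (X.inertia x).inv_mem hi, by rw [map_inv, inv_smul_smul]⟩
  trans := by
    rintro S T U ⟨i, hi, rfl⟩ ⟨j, hj, rfl⟩
    exact ⟨j * i, (X.inertia x).mul_mem hj hi, by rw [map_mul, mul_smul]⟩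

/-- The setoid of `I_x`-conjugacy on the splittings at `x`. [cite: MochizukiGalSect2005, §4 p.33] -/
def splittingSetoid (X : TemperedCurve p) (x : X.Pt) : Setoid (splittings X x) where
  r S T := InertiaConj X x S.1 T.1
  iseqv :=
    { refl := fun S => (inertiaConj_equivalence X x).refl S.1
      symm := fun h => (inertiaConj_equivalence X x).symm h
      trans := fun h₁ h₂ => (inertiaConj_equivalence X x).trans h₁ h₂ }

/-- **The underlying set of the torsor of splittings** ([GalSect] §4 p.33 "whose splittings form a torsor
over `H¹(G_K, Ẑ(1))`"): splittings modulo `I_x`-conjugation (READING NOTE R1).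
[cite: MochizukiGalSect2005, §4 p.33] -/
def SplittingClass (X : TemperedCurve p) (x : X.Pt) : Type := Quotient (splittingSetoid X x)

/-- The class of a splitting. [cite: MochizukiGalSect2005, §4 p.33] -/
def SplittingClass.mk {X : TemperedCurve p} {x : X.Pt} (S : Subgroup X.PiTemp)
    (hS : S ∈ splittings X x) : SplittingClass X x :=
  Quotient.mk (splittingSetoid X x) ⟨S, hS⟩

/-- Every splitting class is the class of a splitting — PROVED. [cite: MochizukiGalSect2005, §4 p.33] -/
theorem SplittingClass.exists_rep {X : TemperedCurve p} {x : X.Pt} (c : SplittingClass X x) :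
    ∃ (S : Subgroup X.PiTemp) (hS : S ∈ splittings X x), SplittingClass.mk S hS = c := by
  induction c using Quotient.inductionOn with
  | h S => exact ⟨S.1, S.2, rfl⟩

/-- The set of splitting classes met by a set of splitting subgroups (used to read L3's canonical
structures, which are SETS of splittings, inside the torsor). [cite: MochizukiGalSect2005, Def 4.1 (iii) p.34] -/
def classesOf {X : TemperedCurve p} {x : X.Pt} (𝒮 : Set (Subgroup X.PiTemp)) :
    Set (SplittingClass X x) :=
  {c | ∃ (S : Subgroup X.PiTemp) (hS : S ∈ splittings X x), S ∈ 𝒮 ∧ SplittingClass.mk S hS = c}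

/-- Conversely, the splitting subgroups whose class lies in a set of classes.
[cite: MochizukiGalSect2005, Def 4.1 (i) p.33] -/
def subgroupsOf {X : TemperedCurve p} {x : X.Pt} (R : Set (SplittingClass X x)) :
    Set (Subgroup X.PiTemp) :=
  {S | ∃ hS : S ∈ splittings X x, SplittingClass.mk S hS ∈ R}

/-! ### The structure group `(K^×)^∧` (real) and the torsor structure (p.33; interface data) -/

/-- **`(K^×)^∧`**, "the profinite completion" of `K^×` ([GalSect] §4 p.33), as a profinite group: Mathlib's
`ProfiniteGrp.ProfiniteCompletion.completion` of `K^×` (the construction the tree's `SemiGraphs.ZHat` uses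
for `Ẑ`). [cite: MochizukiGalSect2005, §4 p.33] -/
abbrev KxHat (X : TemperedCurve p) : ProfiniteGrp.{0} :=
  ProfiniteGrp.ProfiniteCompletion.completion (GrpCat.of (↥X.K)ˣ)

/-- The canonical map `K^× → (K^×)^∧` (p.33; injective — "`K^× ⊆ (K^×)^∧`", p.41 — since `K^× ≅ ℤ × O_K^×`
is residually finite: Mathlib `etaFn_injective_iff_residuallyFinite`; not needed below, not proved here).
[cite: MochizukiGalSect2005, §4 p.33] -/
def toKxHat (X : TemperedCurve p) : (↥X.K)ˣ →* KxHat X :=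
  (ProfiniteGrp.ProfiniteCompletion.eta (GrpCat.of (↥X.K)ˣ)).hom

/-- `O_K^× ⊆ K^×`: the elements of `K ⊆ ℚ̄_p` of absolute value `1` (as L2's `ThetaSetting.unitsOK`).
[cite: MochizukiGalSect2005, §4 p.33] -/
def unitsOK (X : TemperedCurve p) : Subgroup (↥X.K)ˣ where
  carrier := {u | ‖((u : X.K) : PadicAlgCl p)‖ = 1}
  one_mem' := by simp
  mul_mem' {a b} ha hb := by
    simp only [Set.mem_setOf_eq, Units.val_mul, IntermediateField.coe_mul, norm_mul] at ha hb ⊢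
    rw [ha, hb, mul_one]
  inv_mem' {a} ha := by
    simp only [Set.mem_setOf_eq] at ha ⊢
    have h : ((↑(a⁻¹ : (↥X.K)ˣ) : X.K) : PadicAlgCl p) = (((a : X.K) : PadicAlgCl p))⁻¹ := by
      rw [Units.val_inv_eq_inv_val]; push_cast; rfl
    rw [h, norm_inv, ha, inv_one]

/-- `μ_n(K) ⊆ O_K^×`, "the subgroup of `n`-th roots of unity" (Cor. 4.12, p.43), inside `K^×`.
[cite: MochizukiGalSect2005, Cor 4.12 p.43] -/
def rootsOfUnityK (X : TemperedCurve p) (n : ℕ) : Subgroup (↥X.K)ˣ where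
  carrier := {u | u ^ n = 1}
  one_mem' := by simp
  mul_mem' {a b} ha hb := by
    simp only [Set.mem_setOf_eq] at ha hb ⊢
    rw [mul_pow, ha, hb, one_mul]
  inv_mem' {a} ha := by
    simp only [Set.mem_setOf_eq] at ha ⊢
    rw [inv_pow, ha, inv_one]

/-- `O_K^× ⊆ (K^×)^∧` (the image of `O_K^×`; `(O_K^×)^∧ = O_K^×`, p.33). [cite: MochizukiGalSect2005, §4 p.33] -/
def unitsHat (X : TemperedCurve p) : Subgroup (KxHat X) := (unitsOK X).map (toKxHat X)

/-- `K^× ⊆ (K^×)^∧` (p.33). [cite: MochizukiGalSect2005, §4 p.33] -/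
def discreteHat (X : TemperedCurve p) : Subgroup (KxHat X) := (toKxHat X).range

/-- **The `(K^×)^∧`-torsor of splittings at the cusp `x`** ([GalSect] §4 p.33) as INTERFACE data on a §6
datum: the simply transitive ACTION of `(K^×)^∧` on the splitting classes — i.e. the content of "whose
splittings form a torsor over `H¹(G_K, Ẑ(1)) ≅ (K^×)^∧`" (the `H¹(G_K, I_x)`-torsor of sections composed
with the Kummer / local-class-field-theory identification; plan/FOUNDATIONS.md rows 10, 15).  Nothing
asserts such data EXIST for a given `X`; genuineness = `CuspidalTorsorOrigin.IsTorsorOrigin`.  INTERFACE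
BOUNDARY -- TODO-merge: abc-iut-L4-t4 (`LocalClassFieldTheoryForms`), abc-iut-L2-t3 (Kummer map N13),
abc-iut-L2-t12 (`ContH1` of `G_K`). [cite: MochizukiGalSect2005, §4 p.33] -/
structure CuspidalTorsorData (X : TemperedCurve p) (x : X.Pt) : Type where
  /-- The action of `(K^×)^∧ ≅ H¹(G_K, Ẑ(1))` on the classes of splittings (p.33). -/
  act : KxHat X → SplittingClass X x → SplittingClass X x
  /-- `1` acts trivially. -/
  act_one : ∀ c, act 1 c = c
  /-- `k·k′` acts as `k ∘ k′`. -/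
  act_mul : ∀ k k' c, act (k * k') c = act k (act k' c)
  /-- "form a torsor" (p.33): the action is free and transitive. -/
  existsUnique_act_eq : ∀ c c' : SplittingClass X x, ∃! k : KxHat X, act k c = c'

namespace CuspidalTorsorData

variable {X : TemperedCurve p} {x : X.Pt} (T : CuspidalTorsorData X x)

/-! ### Def. 4.1 (i): change of structure group and reductions of structure group -/

/-- The relation defining `A ×^{(K^×)^∧} (torsor)`: `(a, c) ∼ (a·φ(k)⁻¹, k·c)`.
[cite: MochizukiGalSect2005, Def 4.1 (i) p.33] -/
def pushoutRel {A : Type*} [Group A] (φ : KxHat X →* A) (s t : A × SplittingClass X x) : Prop :=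
  ∃ k : KxHat X, t.1 = s.1 * (φ k)⁻¹ ∧ t.2 = T.act k s.2

/-- `pushoutRel` is an equivalence relation — PROVED. [cite: MochizukiGalSect2005, Def 4.1 (i) p.33] -/
theorem pushoutRel_equivalence {A : Type*} [Group A] (φ : KxHat X →* A) :
    Equivalence (T.pushoutRel φ) where
  refl s := ⟨1, by simp, (T.act_one s.2).symm⟩
  symm := by
    rintro s t ⟨k, h1, h2⟩
    refine ⟨k⁻¹, ?_, ?_⟩
    · rw [h1, map_inv, inv_inv, inv_mul_cancel_right]
    · rw [h2, ← T.act_mul, inv_mul_cancel, T.act_one]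
  trans := by
    rintro s t u ⟨k, h1, h2⟩ ⟨k', h1', h2'⟩
    refine ⟨k' * k, ?_, ?_⟩
    · rw [h1', h1, map_mul, mul_inv_rev, mul_assoc]
    · rw [h2', h2, ← T.act_mul]

/-- The setoid of `pushoutRel`. [cite: MochizukiGalSect2005, Def 4.1 (i) p.33] -/
def pushoutSetoid {A : Type*} [Group A] (φ : KxHat X →* A) : Setoid (A × SplittingClass X x) where
  r := T.pushoutRel φ
  iseqv := T.pushoutRel_equivalence φ

/-- **Def. 4.1 (i), the `A`-torsor at `x`** along a (continuous) homomorphism `φ : (K^×)^∧ → A`: "the torsor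
obtained from the torsor of splittings … by changing the structure group via this homomorphism" — the
contracted product `A ×^{(K^×)^∧} T`. (Continuity of `φ` plays no role in the construction and is not
demanded here.) [cite: MochizukiGalSect2005, Def 4.1 (i) p.33] -/
def ATorsor {A : Type*} [Group A] (φ : KxHat X →* A) : Type _ := Quotient (T.pushoutSetoid φ)

/-- The point `[(a, c)]` of the `A`-torsor at `x`. [cite: MochizukiGalSect2005, Def 4.1 (i) p.33] -/
def ATorsor.mk {A : Type*} [Group A] (φ : KxHat X →* A) (a : A) (c : SplittingClass X x) :
    T.ATorsor φ :=
  Quotient.mk (T.pushoutSetoid φ) (a, c)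

/-- The structure map from the torsor of splittings to the `A`-torsor at `x` (`c ↦ [(1, c)]`).
[cite: MochizukiGalSect2005, Def 4.1 (i) p.33] -/
def ATorsor.ofClass {A : Type*} [Group A] (φ : KxHat X →* A) (c : SplittingClass X x) : T.ATorsor φ :=
  ATorsor.mk T φ 1 c

/-- The `A`-action on the `A`-torsor at `x`: `a′ · [(a, c)] = [(a′a, c)]` — PROVED well defined (left and
right multiplication commute). [cite: MochizukiGalSect2005, Def 4.1 (i) p.33] -/
def ATorsor.act {A : Type*} [Group A] (φ : KxHat X →* A) (a' : A) : T.ATorsor φ → T.ATorsor φ :=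
  Quotient.map (fun s : A × SplittingClass X x => (a' * s.1, s.2)) (by
    rintro s t ⟨k, h1, h2⟩
    exact ⟨k, by rw [h1, mul_assoc], h2⟩)

/-- `ATorsor.act` on representatives. [cite: MochizukiGalSect2005, Def 4.1 (i) p.33] -/
theorem ATorsor.act_mk {A : Type*} [Group A] (φ : KxHat X →* A) (a' a : A) (c : SplittingClass X x) :
    ATorsor.act T φ a' (ATorsor.mk T φ a c) = ATorsor.mk T φ (a' * a) c :=
  rfl

/-- `1` acts trivially on the `A`-torsor — PROVED. [cite: MochizukiGalSect2005, Def 4.1 (i) p.33] -/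
theorem ATorsor.act_one {A : Type*} [Group A] (φ : KxHat X →* A) (t : T.ATorsor φ) :
    ATorsor.act T φ 1 t = t := by
  induction t using Quotient.inductionOn with
  | h s => exact congrArg (Quotient.mk _) (by simp)

/-- The action is multiplicative — PROVED. [cite: MochizukiGalSect2005, Def 4.1 (i) p.33] -/
theorem ATorsor.act_mul {A : Type*} [Group A] (φ : KxHat X →* A) (a b : A) (t : T.ATorsor φ) :
    ATorsor.act T φ (a * b) t = ATorsor.act T φ a (ATorsor.act T φ b t) := by
  induction t using Quotient.inductionOn with
  | h s => exact congrArg (Quotient.mk _) (by simp [mul_assoc])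

/-- The structure map is `(K^×)^∧`-equivariant: `[(1, k·c)] = φ(k) · [(1, c)]` — PROVED.
[cite: MochizukiGalSect2005, Def 4.1 (i) p.33] -/
theorem ATorsor.ofClass_act {A : Type*} [Group A] (φ : KxHat X →* A) (k : KxHat X) (c : SplittingClass X x) :
    ATorsor.ofClass T φ (T.act k c) = ATorsor.act T φ (φ k) (ATorsor.ofClass T φ c) := by
  rw [ATorsor.ofClass, ATorsor.ofClass, ATorsor.act_mk, mul_one]
  exact Quotient.sound ⟨k⁻¹, by simp, by rw [← T.act_mul, inv_mul_cancel, T.act_one]⟩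

/-- **Def. 4.1 (i), a `B`-torsor structure at `x`** for a (closed) subgroup `B ⊆ A`: "any reduction of the
structure group of the `A`-torsor at `x` from `A` to `B`" — a `B`-orbit in the `A`-torsor (closedness of
`B` is a standing convention of print, not needed to state the notion). [cite: MochizukiGalSect2005, Def 4.1 (i) p.34] -/
def IsTorsorStructure {A : Type*} [Group A] (φ : KxHat X →* A) (B : Subgroup A)
    (R : Set (T.ATorsor φ)) : Prop :=
  ∃ t ∈ R, R = {s | ∃ b ∈ B, s = ATorsor.act T φ b t}

/-- The special case `A = (K^×)^∧`, `φ = id`: a `B`-torsor structure ON THE TORSOR OF SPLITTINGS ITSELF for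
`B ⊆ (K^×)^∧` — a `B`-orbit of splitting classes (this is the shape Def. 4.1 (ii) uses).
[cite: MochizukiGalSect2005, Def 4.1 (i) p.34] -/
def IsStructure (B : Subgroup (KxHat X)) (R : Set (SplittingClass X x)) : Prop :=
  ∃ c ∈ R, R = {c' | ∃ b ∈ B, c' = T.act b c}

end CuspidalTorsorData

end GalSect

end Literature.AnabelianGeometry.EtaleTheta

end
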